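import Summits.AtomisticToContinuum.HydrodynamicLimit.Theses.TwoClocks
import Summits.AtomisticToContinuum.HydrodynamicLimit.Theorems.TwoClocksTransferActivityTailsDriftTransfer
import HarnessLib

/-!
# Skeleton v2 — crux stmt-AtomisticToContinuum-16624 `TwoClocks.TransferActivityTails`, line `Sketch`
# (crux-ideate round 2, ideator 5, card `predictor-drift-doob`), lead prover-line-…-16624-a1-0

v2 = v1 with every PROVABLE stub landed and imported (lead a1 + workers, 2026-08-17):
* `stub_driftEngine`          — `Theorems/TwoClocksTransferActivityTailsDriftEngine.lean` (p141925)
* `stub_blockActAEMeasurable` — `Theorems/TwoClocksTransferActivityTailsBlockActAEMeasurable.lean` (p141206)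
* `stub_blockAverage`         — `Theorems/TwoClocksTransferActivityTailsBlockAverage.lean` (p141710)
* `stub_windowSandwich`       — `Theorems/TwoClocksTransferActivityTailsWindowSandwich.lean` (p141484)
* `stub_driftTransfer`        — `Theorems/TwoClocksTransferActivityTailsDriftTransfer.lean` (+ `…DriftTransferTools`
  p142292, `…DriftTransferFixedN`): the composition, PROVED.
What remains are exactly the line's two DYNAMICAL posits, both OPEN (worker audits attached as evidence on the item:
not cheaply true, not cheaply false, no misstatement; no typed sufficient input exists in Literature/ or Summits/):
* `stub_predictorDrift : PredictorDrift` — (CD) one-step predictor drift of the tagged sphere's block transfer activity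
  under the true pre-shock law (constants `τ₁, ρ < 1, C, L` after profiles/σ/Φ/t; `N₀` after `K`);
* `stub_oneBlockUI : OneBlockUI` — (UI₁) particle-averaged one-block uniform integrability under the true law.
`TransferActivityTails_of` concludes the crux BY NAME from them.  (The REGISTERED skeleton of this crux is the concurrent
lead c6's `Lines/Sketch.lean`, same line; this file is published as `Lines/Sketch_a1.lean` and is not re-registered so as
not to expire c6's stubs.)
-/

noncomputable section

namespace Summit.AtomisticToContinuum.HydrodynamicLimit.Theorems.TransferActivityTailsDriftLine

open Summit.AtomisticToContinuum.HydrodynamicLimit.Theorems.TransferActivityTailsDriftTransfer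
  (PredictorDrift OneBlockUI stub_driftTransfer)
open Summit.AtomisticToContinuum.HydrodynamicLimit.Theorems.TransferActivityTailsDriftEngine (stub_driftEngine)
open Summit.AtomisticToContinuum.HydrodynamicLimit.Theorems.TransferActivityTailsDriftBlockActAEMeasurable
  (stub_blockActAEMeasurable)
open Summit.AtomisticToContinuum.HydrodynamicLimit.Theorems.TransferActivityTailsDriftBlockAverage (stub_blockAverage)
open Summit.AtomisticToContinuum.HydrodynamicLimit.Theorems.TransferActivityTailsDriftWindowSandwich
  (stub_windowSandwich)

/-! ## The two open stubs (the line's dynamical content) -/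

/-- Stub (OPEN, dynamical): the predictor drift (CD). -/
theorem stub_predictorDrift : PredictorDrift := by
  sorry

/-- Stub (OPEN, dynamical): one-block uniform integrability (UI₁). -/
theorem stub_oneBlockUI : OneBlockUI := by
  sorry

/-! ## The crux by name -/

/-- **The crux from the line's stubs** — five landed, two open (line `Sketch`, card `predictor-drift-doob`). -/
theorem TransferActivityTails_of :
    Summit.AtomisticToContinuum.HydrodynamicLimit.Theses.TwoClocks.TransferActivityTails :=
  stub_driftTransfer stub_driftEngine stub_blockActAEMeasurable stub_blockAverage stub_windowSandwich
    stub_predictorDrift stub_oneBlockUI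

end Summit.AtomisticToContinuum.HydrodynamicLimit.Theorems.TransferActivityTailsDriftLine

end
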